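import Summits.ResolutionOfSingularities.ResolutionOfSingularities.Theorems.FrobeniusLadderFInjectiveMacaulayficationTauFloorBXChartAlgebra
import HarnessLib

/-!
# (O-1′-Y) The Rees chart `D(ȳ)` of `Bl_τ(P2d5C)` as an ITERATED MONIC EXTENSION `T₂ = k[y, w, u′, t′, s′][x][z′]`: tower algebra, universal property,
# extensionality, `y` a non-zero-divisor, the kill map `κ` (`y, x, z′ ↦ 0`), `height (y) = 1`, and the CM clause at EVERY prime of `T₂`
# (crux `FInjectiveMacaulayfication` stmt-ResolutionOfSingularities-15315, chain w45a; res-L1-w45a-plan-1 g19 RULING R19.15 «(O-1′) the FIRST d = 5 kernel row, input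
# side → stub-1»; CLONE of res-L1-w45a-stub-2 g8's (N2-X) `…TauFloorBXChartAlgebra` (p634333) one dimension up; seat res-L1-w45a-stub-1 g11)

[OURS · L1 W4.5a] Support file (`--supports stmt-ResolutionOfSingularities-15315 --as helper`); replaces the role of NO printed item; NOT a statement of any
manuscript; def-free (the tower polynomials are hypotheses `h₁ h₂` with their defining equations); UNCONDITIONAL; characteristic-free (any field `k`). AI-written (AI review
is weaker than expert review).

SETTING. `A₀ = k[X0..X5]/(f)`, `f = X5² + X0⁴X5 + X1³ + X2³ + X3³ + X4³` (P2d5C: `x,y,u,t,s,z = X0..X5`), `τ = (x̄², ȳ, ū, t̄, s̄, z̄)`. The chart `D(ȳ)` of `Bl_τ X` has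
ring `A₀[x̄²/ȳ, ū/ȳ, t̄/ȳ, s̄/ȳ, z̄/ȳ]`: with `w = x²/y`, `u = yu′`, `t = yt′`, `s = ys′`, `z = yz′`: `x² = yw` and `f = y²·(z′² + y w² z′ + y(1 + u′³ + t′³ + s′³))`
(`x⁴z = y²w²·yz′`). We type it as the TOWER `T₂ = B₀[x][z′]`, `B₀ = MvPolynomial (Fin 5) k` (`X 0 = y`, `X 1 = w`, `X 2 = u′`, `X 3 = t′`, `X 4 = s′`),
`T₁ = AdjoinRoot h₁`, `h₁ = X² − C(yw)` (root `x̄`), `T₂ = AdjoinRoot h₂`, `h₂ = Z² + (C(y w²)·Z + C(y(1 + u′³ + t′³ + s′³)))` (root `z̄′`) — both MONIC, so `T₂` is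
FREE and FINITE over `B₀`.
* §1 `monic_h₁`, `free_finite₁`, `root₁_sq`, `natDegree_h₁_le`, `monic_h₂`, `free_finite₂`, `free_finite_tower`, `natDegree_h₂_le`, `root₂_rel`, `algebraMap_tower_apply(')`,
  `x_sq_eq` (`x̄² = ȳ w̄`), `z_sq_eq` (`z̄′² = −(ȳ w̄² z̄′ + ȳ(1 + ū′³ + t̄′³ + s̄′³))`), ★ `algebraMap_X0_mem_nonZeroDivisors` (`ȳ` is a non-zero-divisor: flatness);
* §2 ★ `exists_towerLift` (UNIVERSAL PROPERTY), `tower₂_ringHom_ext`, the substitution `y ↦ 0` on `B₀` (`killY_X`, `sub_killY_mem`, `ker_killY_eq = (y)`, `isPrime_span_X0`,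
  ★ `height_span_X0 = 1`), ★ `exists_killMap` (`κ : T₂ → B₀`: `y ↦ 0` on `B₀`, `x̄, z̄′ ↦ 0`);
* §3 ★ `cmCl_localization` / `cmCl_stalk` — the CM clause at EVERY prime / point of `T₂` (ONE `exact` over res-L1-w45a-stub-3's `FlatIntegralCM.cmCl_localization_of_isRegularRing`).
Sequels: `…TauFloorP2d5CYChartIdent` (`T₂ ≃+* blowupAlgebra τ ȳ`), `…TauFloorP2d5CYChartNotFull` (`¬ FullCl 2` at `ker κ = (x̄, ȳ, z̄′)`).
[cite: GortzWedhorn2020, (13.19) p. 415] [cite: Matsumura1987, Thm. 13.5, Thm. 17.8, Thm. 23.3 (context)]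
-/

-- single-problem summit: the doubled namespace component is forced
set_option linter.dupNamespace false

noncomputable section

namespace Summit.ResolutionOfSingularities.ResolutionOfSingularities.Theorems.FInjectiveMacaulayfication.TauFloorP2d5CYChartAlgebra

open MvPolynomial IsLocalization
open Summit.ResolutionOfSingularities.ResolutionOfSingularities.Theorems.FInjectiveMacaulayfication
open SliceableCentre

variable (k : Type) [Field k]

/-! ## §1 The tower `T₂ = k[y, w, u′, t′, s′][x][z′]` -/

/-- `h₁ = X² − yw` is monic. [plumbing] -/
theorem monic_h₁ (h₁ : Polynomial (MvPolynomial (Fin 5) k)) (hh₁ : h₁ = Polynomial.X ^ 2 - Polynomial.C (X 0 * X 1)) : h₁.Monic := by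
  rw [hh₁]; exact Polynomial.monic_X_pow_sub_C _ two_ne_zero

/-- `T₁` is free and finite over `B₀`. [Mathlib `AdjoinRoot.powerBasis'`] -/
theorem free_finite₁ (h₁ : Polynomial (MvPolynomial (Fin 5) k)) (hh₁ : h₁ = Polynomial.X ^ 2 - Polynomial.C (X 0 * X 1)) :
    Module.Free (MvPolynomial (Fin 5) k) (AdjoinRoot h₁) ∧ Module.Finite (MvPolynomial (Fin 5) k) (AdjoinRoot h₁) :=
  ⟨Module.Free.of_basis (AdjoinRoot.powerBasis' (monic_h₁ k h₁ hh₁)).basis, (AdjoinRoot.powerBasis' (monic_h₁ k h₁ hh₁)).finite⟩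

/-- `x̄² = yw` in `T₁`. [plumbing] -/
theorem root₁_sq (h₁ : Polynomial (MvPolynomial (Fin 5) k)) (hh₁ : h₁ = Polynomial.X ^ 2 - Polynomial.C (X 0 * X 1)) :
    AdjoinRoot.root h₁ ^ 2 = AdjoinRoot.of h₁ (X 0 * X 1) := by
  subst hh₁
  have h := AdjoinRoot.eval₂_root (Polynomial.X ^ 2 - Polynomial.C (X 0 * X 1 : MvPolynomial (Fin 5) k))
  rw [Polynomial.eval₂_sub, Polynomial.eval₂_X_pow, Polynomial.eval₂_C, sub_eq_zero] at h
  exact h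

/-- `natDegree h₁ ≤ 2`. [plumbing] -/
theorem natDegree_h₁_le (h₁ : Polynomial (MvPolynomial (Fin 5) k)) (hh₁ : h₁ = Polynomial.X ^ 2 - Polynomial.C (X 0 * X 1)) : h₁.natDegree ≤ 2 := by
  rw [hh₁]
  refine (Polynomial.natDegree_sub_le _ _).trans (max_le (Polynomial.natDegree_X_pow_le 2) ?_)
  rw [Polynomial.natDegree_C]; exact Nat.zero_le _

/-- `h₂ = Z² + (y w²)·Z + y(1 + u′³ + t′³ + s′³)` is monic. [plumbing] -/
theorem monic_h₂ (h₁ : Polynomial (MvPolynomial (Fin 5) k)) (h₂ : Polynomial (AdjoinRoot h₁))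
    (hh₂ : h₂ = Polynomial.X ^ 2 + (Polynomial.C (algebraMap (MvPolynomial (Fin 5) k) (AdjoinRoot h₁) (X 0 * X 1 ^ 2)) * Polynomial.X +
      Polynomial.C (algebraMap (MvPolynomial (Fin 5) k) (AdjoinRoot h₁) (X 0 * (1 + X 2 ^ 3 + X 3 ^ 3 + X 4 ^ 3))))) : h₂.Monic := by
  rw [hh₂]
  nontriviality (AdjoinRoot h₁)
  refine Polynomial.monic_X_pow_add ?_
  refine (Polynomial.degree_add_le _ _).trans_lt ?_
  refine max_lt ((Polynomial.degree_C_mul_X_le _).trans_lt (by exact_mod_cast Nat.lt_succ_self 1)) ?_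
  exact (Polynomial.degree_C_le).trans_lt (by exact_mod_cast Nat.succ_pos 1)

/-- `T₂` is free and finite over `T₁`. [Mathlib `AdjoinRoot.powerBasis'`] -/
theorem free_finite₂ (h₁ : Polynomial (MvPolynomial (Fin 5) k)) (h₂ : Polynomial (AdjoinRoot h₁))
    (hh₂ : h₂ = Polynomial.X ^ 2 + (Polynomial.C (algebraMap (MvPolynomial (Fin 5) k) (AdjoinRoot h₁) (X 0 * X 1 ^ 2)) * Polynomial.X +
      Polynomial.C (algebraMap (MvPolynomial (Fin 5) k) (AdjoinRoot h₁) (X 0 * (1 + X 2 ^ 3 + X 3 ^ 3 + X 4 ^ 3))))) :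
    Module.Free (AdjoinRoot h₁) (AdjoinRoot h₂) ∧ Module.Finite (AdjoinRoot h₁) (AdjoinRoot h₂) :=
  ⟨Module.Free.of_basis (AdjoinRoot.powerBasis' (monic_h₂ k h₁ h₂ hh₂)).basis, (AdjoinRoot.powerBasis' (monic_h₂ k h₁ h₂ hh₂)).finite⟩

/-- ★ **`T₂` is FREE and FINITE over `B₀ = k[y, w, u′, t′, s′]`** (monic tower). [folklore] -/
theorem free_finite_tower (h₁ : Polynomial (MvPolynomial (Fin 5) k)) (hh₁ : h₁ = Polynomial.X ^ 2 - Polynomial.C (X 0 * X 1))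
    (h₂ : Polynomial (AdjoinRoot h₁))
    (hh₂ : h₂ = Polynomial.X ^ 2 + (Polynomial.C (algebraMap (MvPolynomial (Fin 5) k) (AdjoinRoot h₁) (X 0 * X 1 ^ 2)) * Polynomial.X +
      Polynomial.C (algebraMap (MvPolynomial (Fin 5) k) (AdjoinRoot h₁) (X 0 * (1 + X 2 ^ 3 + X 3 ^ 3 + X 4 ^ 3))))) :
    Module.Free (MvPolynomial (Fin 5) k) (AdjoinRoot h₂) ∧ Module.Finite (MvPolynomial (Fin 5) k) (AdjoinRoot h₂) := by
  obtain ⟨hf₁, hfi₁⟩ := free_finite₁ k h₁ hh₁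
  obtain ⟨hf₂, hfi₂⟩ := free_finite₂ k h₁ h₂ hh₂
  exact ⟨Module.Free.trans (S := AdjoinRoot h₁), Module.Finite.trans (AdjoinRoot h₁) (AdjoinRoot h₂)⟩

/-- `natDegree h₂ ≤ 2`. [plumbing] -/
theorem natDegree_h₂_le (h₁ : Polynomial (MvPolynomial (Fin 5) k)) (h₂ : Polynomial (AdjoinRoot h₁))
    (hh₂ : h₂ = Polynomial.X ^ 2 + (Polynomial.C (algebraMap (MvPolynomial (Fin 5) k) (AdjoinRoot h₁) (X 0 * X 1 ^ 2)) * Polynomial.X +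
      Polynomial.C (algebraMap (MvPolynomial (Fin 5) k) (AdjoinRoot h₁) (X 0 * (1 + X 2 ^ 3 + X 3 ^ 3 + X 4 ^ 3))))) : h₂.natDegree ≤ 2 := by
  rw [hh₂]
  refine (Polynomial.natDegree_add_le _ _).trans (max_le (Polynomial.natDegree_X_pow_le 2) ?_)
  refine (Polynomial.natDegree_add_le _ _).trans (max_le ((Polynomial.natDegree_C_mul_le _ _).trans (Polynomial.natDegree_X_le.trans one_le_two)) ?_)
  rw [Polynomial.natDegree_C]; exact Nat.zero_le _

/-- The relation `z̄′² + (y w²) z̄′ + y(1 + u′³ + t′³ + s′³) = 0` in `T₂`. [plumbing] -/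
theorem root₂_rel (h₁ : Polynomial (MvPolynomial (Fin 5) k)) (h₂ : Polynomial (AdjoinRoot h₁))
    (hh₂ : h₂ = Polynomial.X ^ 2 + (Polynomial.C (algebraMap (MvPolynomial (Fin 5) k) (AdjoinRoot h₁) (X 0 * X 1 ^ 2)) * Polynomial.X +
      Polynomial.C (algebraMap (MvPolynomial (Fin 5) k) (AdjoinRoot h₁) (X 0 * (1 + X 2 ^ 3 + X 3 ^ 3 + X 4 ^ 3))))) :
    AdjoinRoot.root h₂ ^ 2 + AdjoinRoot.of h₂ (algebraMap (MvPolynomial (Fin 5) k) (AdjoinRoot h₁) (X 0 * X 1 ^ 2)) * AdjoinRoot.root h₂ +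
      AdjoinRoot.of h₂ (algebraMap (MvPolynomial (Fin 5) k) (AdjoinRoot h₁) (X 0 * (1 + X 2 ^ 3 + X 3 ^ 3 + X 4 ^ 3))) = 0 := by
  subst hh₂
  have h := AdjoinRoot.eval₂_root (Polynomial.X ^ 2 + (Polynomial.C (algebraMap (MvPolynomial (Fin 5) k) (AdjoinRoot h₁) (X 0 * X 1 ^ 2)) * Polynomial.X +
      Polynomial.C (algebraMap (MvPolynomial (Fin 5) k) (AdjoinRoot h₁) (X 0 * (1 + X 2 ^ 3 + X 3 ^ 3 + X 4 ^ 3)))))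
  simp only [Polynomial.eval₂_add, Polynomial.eval₂_mul, Polynomial.eval₂_X_pow, Polynomial.eval₂_C, Polynomial.eval₂_X] at h
  linear_combination h

/-- `algebraMap B₀ T₂ = of h₂ ∘ algebraMap B₀ T₁`. [plumbing] -/
theorem algebraMap_tower_apply' (h₁ : Polynomial (MvPolynomial (Fin 5) k)) (h₂ : Polynomial (AdjoinRoot h₁)) (b : MvPolynomial (Fin 5) k) :
    algebraMap (MvPolynomial (Fin 5) k) (AdjoinRoot h₂) b = AdjoinRoot.of h₂ (algebraMap (MvPolynomial (Fin 5) k) (AdjoinRoot h₁) b) := by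
  rw [IsScalarTower.algebraMap_apply (MvPolynomial (Fin 5) k) (AdjoinRoot h₁) (AdjoinRoot h₂), AdjoinRoot.algebraMap_eq]

/-- `algebraMap B₀ T₂ = of h₂ ∘ of h₁`. [plumbing] -/
theorem algebraMap_tower_apply (h₁ : Polynomial (MvPolynomial (Fin 5) k)) (h₂ : Polynomial (AdjoinRoot h₁)) (b : MvPolynomial (Fin 5) k) :
    algebraMap (MvPolynomial (Fin 5) k) (AdjoinRoot h₂) b = AdjoinRoot.of h₂ (AdjoinRoot.of h₁ b) := by
  rw [algebraMap_tower_apply', AdjoinRoot.algebraMap_eq]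

/-- `x̄² = ȳ·w̄` in `T₂`. [plumbing] -/
theorem x_sq_eq (h₁ : Polynomial (MvPolynomial (Fin 5) k)) (hh₁ : h₁ = Polynomial.X ^ 2 - Polynomial.C (X 0 * X 1)) (h₂ : Polynomial (AdjoinRoot h₁)) :
    AdjoinRoot.of h₂ (AdjoinRoot.root h₁) ^ 2 = algebraMap (MvPolynomial (Fin 5) k) (AdjoinRoot h₂) (X 0) * algebraMap (MvPolynomial (Fin 5) k) (AdjoinRoot h₂) (X 1) := by
  rw [← map_pow, root₁_sq k h₁ hh₁, map_mul, map_mul, ← algebraMap_tower_apply, ← algebraMap_tower_apply]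

/-- `z̄′² = −(ȳ w̄² z̄′ + ȳ(1 + ū′³ + t̄′³ + s̄′³))` in `T₂`. [plumbing] -/
theorem z_sq_eq (h₁ : Polynomial (MvPolynomial (Fin 5) k)) (h₂ : Polynomial (AdjoinRoot h₁))
    (hh₂ : h₂ = Polynomial.X ^ 2 + (Polynomial.C (algebraMap (MvPolynomial (Fin 5) k) (AdjoinRoot h₁) (X 0 * X 1 ^ 2)) * Polynomial.X +
      Polynomial.C (algebraMap (MvPolynomial (Fin 5) k) (AdjoinRoot h₁) (X 0 * (1 + X 2 ^ 3 + X 3 ^ 3 + X 4 ^ 3))))) :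
    AdjoinRoot.root h₂ ^ 2 = -(algebraMap (MvPolynomial (Fin 5) k) (AdjoinRoot h₂) (X 0) * algebraMap (MvPolynomial (Fin 5) k) (AdjoinRoot h₂) (X 1) ^ 2 * AdjoinRoot.root h₂ +
      algebraMap (MvPolynomial (Fin 5) k) (AdjoinRoot h₂) (X 0) * (1 + algebraMap (MvPolynomial (Fin 5) k) (AdjoinRoot h₂) (X 2) ^ 3 +
        algebraMap (MvPolynomial (Fin 5) k) (AdjoinRoot h₂) (X 3) ^ 3 + algebraMap (MvPolynomial (Fin 5) k) (AdjoinRoot h₂) (X 4) ^ 3)) := by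
  have h := root₂_rel k h₁ h₂ hh₂
  simp only [map_add, map_mul, map_pow, map_one, ← algebraMap_tower_apply'] at h
  linear_combination h

/-- ★ `ȳ` is a NON-ZERO-DIVISOR of `T₂` (`T₂` is free, hence flat, over the domain `B₀`). [folklore] -/
theorem algebraMap_X0_mem_nonZeroDivisors (h₁ : Polynomial (MvPolynomial (Fin 5) k)) (hh₁ : h₁ = Polynomial.X ^ 2 - Polynomial.C (X 0 * X 1))
    (h₂ : Polynomial (AdjoinRoot h₁))
    (hh₂ : h₂ = Polynomial.X ^ 2 + (Polynomial.C (algebraMap (MvPolynomial (Fin 5) k) (AdjoinRoot h₁) (X 0 * X 1 ^ 2)) * Polynomial.X +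
      Polynomial.C (algebraMap (MvPolynomial (Fin 5) k) (AdjoinRoot h₁) (X 0 * (1 + X 2 ^ 3 + X 3 ^ 3 + X 4 ^ 3))))) :
    algebraMap (MvPolynomial (Fin 5) k) (AdjoinRoot h₂) (X 0) ∈ nonZeroDivisors (AdjoinRoot h₂) := by
  obtain ⟨hfree, -⟩ := free_finite_tower k h₁ hh₁ h₂ hh₂
  exact FlatIntegralCM.mem_nonZeroDivisors_algebraMap_of_flat_of_ne_zero (X_ne_zero 0)

/-! ## §2 The universal property of the tower, extensionality, and the kill map `κ` -/

/-- ★ **UNIVERSAL PROPERTY OF `T₂`** (existence): a ring map `g : B₀ → S` and `x₀, z₀ ∈ S` satisfying the two tower relations extend to `κ : T₂ → S`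
with `κ|B₀ = g`, `κ(x̄) = x₀`, `κ(z̄′) = z₀`. [folklore: `AdjoinRoot.lift` twice] -/
theorem exists_towerLift {S : Type} [CommRing S] (h₁ : Polynomial (MvPolynomial (Fin 5) k)) (hh₁ : h₁ = Polynomial.X ^ 2 - Polynomial.C (X 0 * X 1))
    (h₂ : Polynomial (AdjoinRoot h₁))
    (hh₂ : h₂ = Polynomial.X ^ 2 + (Polynomial.C (algebraMap (MvPolynomial (Fin 5) k) (AdjoinRoot h₁) (X 0 * X 1 ^ 2)) * Polynomial.X +
      Polynomial.C (algebraMap (MvPolynomial (Fin 5) k) (AdjoinRoot h₁) (X 0 * (1 + X 2 ^ 3 + X 3 ^ 3 + X 4 ^ 3)))))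
    (g : MvPolynomial (Fin 5) k →+* S) (x₀ z₀ : S) (hx : x₀ ^ 2 = g (X 0) * g (X 1))
    (hz : z₀ ^ 2 + g (X 0) * g (X 1) ^ 2 * z₀ + g (X 0) * (1 + g (X 2) ^ 3 + g (X 3) ^ 3 + g (X 4) ^ 3) = 0) :
    ∃ κ : AdjoinRoot h₂ →+* S, κ.comp (algebraMap (MvPolynomial (Fin 5) k) (AdjoinRoot h₂)) = g ∧
      κ (AdjoinRoot.of h₂ (AdjoinRoot.root h₁)) = x₀ ∧ κ (AdjoinRoot.root h₂) = z₀ := by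
  have e1 : Polynomial.eval₂ g x₀ h₁ = 0 := by
    rw [hh₁, Polynomial.eval₂_sub, Polynomial.eval₂_X_pow, Polynomial.eval₂_C, map_mul, hx, sub_self]
  have hκ₁of : ∀ b, AdjoinRoot.lift g x₀ e1 (AdjoinRoot.of h₁ b) = g b := fun b => AdjoinRoot.lift_of e1
  have hκ₁root : AdjoinRoot.lift g x₀ e1 (AdjoinRoot.root h₁) = x₀ := AdjoinRoot.lift_root e1
  have e2 : Polynomial.eval₂ (AdjoinRoot.lift g x₀ e1) z₀ h₂ = 0 := by
    rw [hh₂]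
    simp only [Polynomial.eval₂_add, Polynomial.eval₂_mul, Polynomial.eval₂_pow, Polynomial.eval₂_C, Polynomial.eval₂_X, Polynomial.eval₂_one,
      AdjoinRoot.algebraMap_eq, map_add, map_mul, map_pow, map_one, hκ₁of]
    linear_combination hz
  refine ⟨AdjoinRoot.lift _ z₀ e2, RingHom.ext fun b => ?_, ?_, AdjoinRoot.lift_root e2⟩
  · rw [RingHom.comp_apply, algebraMap_tower_apply, AdjoinRoot.lift_of e2, hκ₁of]
  · rw [AdjoinRoot.lift_of e2, hκ₁root]

/-- **Extensionality out of `T₂`**: two ring maps `T₂ → S` agreeing on `B₀`, on `x̄` and on `z̄′` are equal. [folklore] -/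
theorem tower₂_ringHom_ext {S : Type} [CommRing S] (h₁ : Polynomial (MvPolynomial (Fin 5) k)) (h₂ : Polynomial (AdjoinRoot h₁))
    {φ ψ : AdjoinRoot h₂ →+* S} (hB : φ.comp (algebraMap (MvPolynomial (Fin 5) k) (AdjoinRoot h₂)) = ψ.comp (algebraMap (MvPolynomial (Fin 5) k) (AdjoinRoot h₂)))
    (hx : φ (AdjoinRoot.of h₂ (AdjoinRoot.root h₁)) = ψ (AdjoinRoot.of h₂ (AdjoinRoot.root h₁))) (hz : φ (AdjoinRoot.root h₂) = ψ (AdjoinRoot.root h₂)) :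
    φ = ψ := by
  refine TauFloorF5YChartAlgebra.adjoinRoot_ringHom_ext (fun r => ?_) hz
  have h1 : φ.comp (AdjoinRoot.of h₂) = ψ.comp (AdjoinRoot.of h₂) := by
    refine TauFloorF5YChartAlgebra.adjoinRoot_ringHom_ext (fun b => ?_) hx
    have := RingHom.congr_fun hB b
    simp only [RingHom.comp_apply, algebraMap_tower_apply] at this ⊢
    exact this
  exact RingHom.congr_fun h1 r

/-- The substitution `y ↦ 0` on `B₀ = k[y, w, u′, t′, s′]`, on variables. [plumbing] -/
theorem killY_X (j : Fin 5) :
    aeval (fun i : Fin 5 => if i = 0 then (0 : MvPolynomial (Fin 5) k) else X i) (X j : MvPolynomial (Fin 5) k) = if j = 0 then 0 else X j := by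
  rw [aeval_X]

/-- `q − q(y ↦ 0) ∈ (y)` for every `q ∈ B₀`. [folklore] -/
theorem sub_killY_mem (q : MvPolynomial (Fin 5) k) :
    q - aeval (fun i : Fin 5 => if i = 0 then (0 : MvPolynomial (Fin 5) k) else X i) q ∈ Ideal.span ({X 0} : Set (MvPolynomial (Fin 5) k)) := by
  induction q using MvPolynomial.induction_on with
  | C a => rw [MvPolynomial.algHom_C]; simp
  | add p q hp hq =>
    rw [map_add, show p + q - (aeval _ p + aeval _ q) = (p - aeval _ p) + (q - aeval _ q) by ring]
    exact Ideal.add_mem _ hp hq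
  | mul_X p i hp =>
    rw [map_mul, killY_X]
    by_cases hi : i = 0
    · rw [if_pos hi, mul_zero, sub_zero, hi]
      exact Ideal.mul_mem_left _ _ (Ideal.subset_span rfl)
    · rw [if_neg hi, show p * X i - aeval _ p * X i = (p - aeval _ p) * X i by ring]
      exact Ideal.mul_mem_right _ _ hp

/-- The kernel of `y ↦ 0` on `B₀` is `(y)`. [folklore] -/
theorem ker_killY_eq :
    RingHom.ker (aeval (fun i : Fin 5 => if i = 0 then (0 : MvPolynomial (Fin 5) k) else X i)).toRingHom = Ideal.span ({X 0} : Set (MvPolynomial (Fin 5) k)) := by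
  apply le_antisymm
  · intro q hq
    rw [RingHom.mem_ker] at hq
    have h := sub_killY_mem k q
    change q - (aeval _).toRingHom q ∈ _ at h
    rwa [hq, sub_zero] at h
  · rw [Ideal.span_le, Set.singleton_subset_iff, SetLike.mem_coe, RingHom.mem_ker]
    change aeval _ (X 0) = 0
    rw [killY_X]; simp

/-- `(y) ⊂ B₀` is prime. [folklore] -/
theorem isPrime_span_X0 : (Ideal.span ({X 0} : Set (MvPolynomial (Fin 5) k))).IsPrime :=
  (Ideal.span_singleton_prime (X_ne_zero 0)).mpr MvPolynomial.X_prime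

/-- ★ `height (y) = 1` in `B₀`: `≤ 1` by Krull's principal ideal theorem, `≥ 1` since `(y) ≠ 0`. [cite: Matsumura1987, Thm. 13.5] -/
theorem height_span_X0 : (Ideal.span ({X 0} : Set (MvPolynomial (Fin 5) k))).height = 1 := by
  classical
  haveI hP := isPrime_span_X0 k
  apply le_antisymm
  · have hmin : Ideal.span ({X 0} : Set (MvPolynomial (Fin 5) k)) ∈
        (Ideal.span ((({X 0} : Finset (MvPolynomial (Fin 5) k)) : Set (MvPolynomial (Fin 5) k)))).minimalPrimes := by
      rw [Finset.coe_singleton, Ideal.minimalPrimes_eq_subsingleton_self]; rfl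
    refine (Ideal.height_le_card_of_mem_minimalPrimes_span_finset hmin).trans ?_
    exact_mod_cast (Finset.card_singleton _).le
  · rw [Order.one_le_iff_ne_zero, Ne, Ideal.height_eq_zero_iff_eq_bot, Ideal.span_singleton_eq_bot]
    exact X_ne_zero 0

/-- ★ **THE KILL MAP `κ : T₂ → B₀`** (`y ↦ 0` on `B₀`, `x̄ ↦ 0`, `z̄′ ↦ 0`) exists: both tower relations die under `y, x, z′ ↦ 0`. [folklore] -/
theorem exists_killMap (h₁ : Polynomial (MvPolynomial (Fin 5) k)) (hh₁ : h₁ = Polynomial.X ^ 2 - Polynomial.C (X 0 * X 1))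
    (h₂ : Polynomial (AdjoinRoot h₁))
    (hh₂ : h₂ = Polynomial.X ^ 2 + (Polynomial.C (algebraMap (MvPolynomial (Fin 5) k) (AdjoinRoot h₁) (X 0 * X 1 ^ 2)) * Polynomial.X +
      Polynomial.C (algebraMap (MvPolynomial (Fin 5) k) (AdjoinRoot h₁) (X 0 * (1 + X 2 ^ 3 + X 3 ^ 3 + X 4 ^ 3))))) :
    ∃ κ : AdjoinRoot h₂ →+* MvPolynomial (Fin 5) k, κ.comp (algebraMap (MvPolynomial (Fin 5) k) (AdjoinRoot h₂)) = (aeval (fun i : Fin 5 => if i = 0 then (0 : MvPolynomial (Fin 5) k) else X i)).toRingHom ∧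
      κ (AdjoinRoot.of h₂ (AdjoinRoot.root h₁)) = 0 ∧ κ (AdjoinRoot.root h₂) = 0 :=
  exists_towerLift k h₁ hh₁ h₂ hh₂ _ 0 0 (by simp) (by simp)

/-! ## §3 The CM clause at every prime of `T₂` -/

/-- ★ **CM AT EVERY PRIME OF `T₂`** — ONE `exact` over res-L1-w45a-stub-3's generic engine: `T₂` is Noetherian, free (⇒ flat) and finite (⇒ integral) over the
REGULAR ring `B₀ = k[y, w, u′, t′, s′]`. [cite: Matsumura1987, Thm. 17.8, Thm. 23.3 (context)] -/
theorem cmCl_localization (h₁ : Polynomial (MvPolynomial (Fin 5) k)) (hh₁ : h₁ = Polynomial.X ^ 2 - Polynomial.C (X 0 * X 1))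
    (h₂ : Polynomial (AdjoinRoot h₁))
    (hh₂ : h₂ = Polynomial.X ^ 2 + (Polynomial.C (algebraMap (MvPolynomial (Fin 5) k) (AdjoinRoot h₁) (X 0 * X 1 ^ 2)) * Polynomial.X +
      Polynomial.C (algebraMap (MvPolynomial (Fin 5) k) (AdjoinRoot h₁) (X 0 * (1 + X 2 ^ 3 + X 3 ^ 3 + X 4 ^ 3)))))
    (Q : Ideal (AdjoinRoot h₂)) [Q.IsPrime] : CMCl (Localization.AtPrime Q) := by
  obtain ⟨hfree, hfin⟩ := free_finite_tower k h₁ hh₁ h₂ hh₂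
  haveI : Algebra.IsIntegral (MvPolynomial (Fin 5) k) (AdjoinRoot h₂) := Algebra.IsIntegral.of_finite _ _
  exact FlatIntegralCM.cmCl_localization_of_isRegularRing (A := MvPolynomial (Fin 5) k) Q

/-- Stalk form: the CM clause holds at EVERY point of `Spec T₂`. [folklore transport] -/
theorem cmCl_stalk (h₁ : Polynomial (MvPolynomial (Fin 5) k)) (hh₁ : h₁ = Polynomial.X ^ 2 - Polynomial.C (X 0 * X 1))
    (h₂ : Polynomial (AdjoinRoot h₁))
    (hh₂ : h₂ = Polynomial.X ^ 2 + (Polynomial.C (algebraMap (MvPolynomial (Fin 5) k) (AdjoinRoot h₁) (X 0 * X 1 ^ 2)) * Polynomial.X +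
      Polynomial.C (algebraMap (MvPolynomial (Fin 5) k) (AdjoinRoot h₁) (X 0 * (1 + X 2 ^ 3 + X 3 ^ 3 + X 4 ^ 3)))))
    (w : AlgebraicGeometry.Spec (.of (AdjoinRoot h₂))) : CMCl ((AlgebraicGeometry.Spec (.of (AdjoinRoot h₂))).presheaf.stalk w) := by
  obtain ⟨hfree, hfin⟩ := free_finite_tower k h₁ hh₁ h₂ hh₂
  haveI : Algebra.IsIntegral (MvPolynomial (Fin 5) k) (AdjoinRoot h₂) := Algebra.IsIntegral.of_finite _ _
  exact FlatIntegralCM.cmCl_stalk_Spec_of_isRegularRing (A := MvPolynomial (Fin 5) k) w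

end Summit.ResolutionOfSingularities.ResolutionOfSingularities.Theorems.FInjectiveMacaulayfication.TauFloorP2d5CYChartAlgebra

end
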